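import Mathlib
import Summits.AnomalousDissipation.AnomalousDissipation.Theses.WazewskiBlock
import Literature.Analysis.FluidPDE.GalerkinFlow
import HarnessLib

/-!
# Birth skeleton of piece P2 `UniformTailEstimates` (tail-lift split of crux stmt-AnomalousDissipation-10352,
# `WazewskiBlock.UniformGalerkinTrap`) — crux-strategist r1

Three named stubs (each an `N`-uniform finite-convolution estimate with its own threshold) and the composition
`uniformTailEstimates_of` (`M := max M₀ (max M₁ M₂)`; sorries ONLY in the stubs):
* `stub_tailEntrance` (clause (i): per-mode tail entrance beyond `M₀ ~ 2·96·C₆(1+√3) A/(πν)`);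
* `stub_tailCoupling` (clause (ii): modewise low/tail coupling below the majorant once `m + 1 ≥ 2π·192·C₆ A/ν`);
* `stub_tailSums` (clauses (iii)/(iv): tail energy/enstrophy `≤ δ` once `4π²·27 A² θ^{2m} ≤ δ`).
`C₆ = ∑_{j∈ℤ³}(1+|j|₁)^{-6} ≤ ∑∏ᵢ(1+|jᵢ|)^{-2} ≤ 27` (via `(1+|j|₁)³ ≥ ∏ᵢ(1+|jᵢ|)`, telescoping `(1+n)^{-2} ≤ 1/n − 1/(n+1)`).
Profile exponent 6 (any `s ≥ 5` works analytically; 6 avoids fractional powers in the lattice sums).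
-/

noncomputable section

set_option linter.dupNamespace false

namespace Summit.AnomalousDissipation.AnomalousDissipation.Cruxes.UniformGalerkinTrap.UniformTailEstimatesBirth

open scoped InnerProductSpace ENNReal NNReal
open MeasureTheory Set Filter Topology
open Literature.Analysis.FunctionSpaces Literature.Analysis.FunctionSpaces.Torus
open Literature.Analysis.FluidPDE

/-- **stub (i) tail entrance.** [folklore] -/
theorem stub_tailEntrance :
    ∀ ν A θ : ℝ, 0 < ν → 0 < A → 0 < θ → θ < 1 → ∃ M : ℕ, ∀ m N : ℕ, M ≤ m → m ≤ N →
      ∀ x : ↥(freqBall N : Finset (Fin 3 → ℤ)) → EuclideanSpace ℂ (Fin 3),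
        (∀ k : ↥(freqBall N : Finset (Fin 3 → ℤ)), ‖x k‖ ≤ A * θ ^ (∑ i, ((k : Fin 3 → ℤ) i).natAbs) / (1 + ∑ i, (((k : Fin 3 → ℤ) i).natAbs : ℝ)) ^ 6) →
        (∀ (g : ↥(freqBall N : Finset (Fin 3 → ℤ)) → EuclideanSpace ℂ (Fin 3)) (k : ↥(freqBall N : Finset (Fin 3 → ℤ))),
            ((m : ℕ) : ℝ) ^ 2 < freqNormSq (k : Fin 3 → ℤ) → g k = 0 →
            ‖x k‖ = A * θ ^ (∑ i, ((k : Fin 3 → ℤ) i).natAbs) / (1 + ∑ i, (((k : Fin 3 → ℤ) i).natAbs : ℝ)) ^ 6 →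
            (inner ℂ (x k) (galerkinRHS (freqBall N : Finset (Fin 3 → ℤ)) ν g x k)).re < 0) := by
  sorry

/-- **stub (ii) tail coupling.** [folklore] -/
theorem stub_tailCoupling :
    ∀ ν A θ : ℝ, 0 < ν → 0 < A → 0 < θ → θ < 1 → ∃ M : ℕ, ∀ m N : ℕ, M ≤ m → m ≤ N →
      ∀ x : ↥(freqBall N : Finset (Fin 3 → ℤ)) → EuclideanSpace ℂ (Fin 3),
        (∀ k : ↥(freqBall N : Finset (Fin 3 → ℤ)), ‖x k‖ ≤ A * θ ^ (∑ i, ((k : Fin 3 → ℤ) i).natAbs) / (1 + ∑ i, (((k : Fin 3 → ℤ) i).natAbs : ℝ)) ^ 6) →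
        (∀ (f : UnitAddTorus (Fin 3) → EuclideanSpace ℝ (Fin 3)) (k : ↥(freqBall m : Finset (Fin 3 → ℤ))),
            ‖coeffExt (freqBall N : Finset (Fin 3 → ℤ)) (galerkinRHS (freqBall N : Finset (Fin 3 → ℤ)) ν (fourierRestrict (freqBall N : Finset (Fin 3 → ℤ)) f) x) (k : Fin 3 → ℤ) -
                galerkinRHS (freqBall m : Finset (Fin 3 → ℤ)) ν (fourierRestrict (freqBall m : Finset (Fin 3 → ℤ)) f)
                  (fun l : ↥(freqBall m : Finset (Fin 3 → ℤ)) => coeffExt (freqBall N : Finset (Fin 3 → ℤ)) x (l : Fin 3 → ℤ)) k‖ ≤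
              ν * A * θ ^ (max (∑ j, ((k : Fin 3 → ℤ) j).natAbs) m) / (1 + ((max (∑ j, ((k : Fin 3 → ℤ) j).natAbs) m : ℕ) : ℝ)) ^ 4) := by
  sorry

/-- **stub (iii)/(iv) tail sums.** [folklore] -/
theorem stub_tailSums :
    ∀ A θ δ : ℝ, 0 < A → 0 < θ → θ < 1 → 0 < δ → ∃ M : ℕ, ∀ m N : ℕ, M ≤ m → m ≤ N →
      ∀ x : ↥(freqBall N : Finset (Fin 3 → ℤ)) → EuclideanSpace ℂ (Fin 3),
        (∀ k : ↥(freqBall N : Finset (Fin 3 → ℤ)), ‖x k‖ ≤ A * θ ^ (∑ i, ((k : Fin 3 → ℤ) i).natAbs) / (1 + ∑ i, (((k : Fin 3 → ℤ) i).natAbs : ℝ)) ^ 6) →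
        (2⁻¹ * ∑ k : ↥(freqBall N : Finset (Fin 3 → ℤ)), ‖x k‖ ^ 2 ≤
          2⁻¹ * ∑ l : ↥(freqBall m : Finset (Fin 3 → ℤ)), ‖coeffExt (freqBall N : Finset (Fin 3 → ℤ)) x (l : Fin 3 → ℤ)‖ ^ 2 + δ ∧
        4 * Real.pi ^ 2 * ∑ k : ↥(freqBall N : Finset (Fin 3 → ℤ)), freqNormSq (k : Fin 3 → ℤ) * ‖x k‖ ^ 2 ≤
          4 * Real.pi ^ 2 * ∑ l : ↥(freqBall m : Finset (Fin 3 → ℤ)),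
            freqNormSq (l : Fin 3 → ℤ) * ‖coeffExt (freqBall N : Finset (Fin 3 → ℤ)) x (l : Fin 3 → ℤ)‖ ^ 2 + δ) := by
  sorry

/-- **Composition**: the three stubs give P2 with `M := max M₀ (max M₁ M₂)`. -/
theorem uniformTailEstimates_of :
    ∀ ν A θ δ : ℝ, 0 < ν → 0 < A → 0 < θ → θ < 1 → 0 < δ → ∃ M : ℕ, ∀ m N : ℕ, M ≤ m → m ≤ N →
      ∀ x : ↥(freqBall N : Finset (Fin 3 → ℤ)) → EuclideanSpace ℂ (Fin 3),
        (∀ k : ↥(freqBall N : Finset (Fin 3 → ℤ)), ‖x k‖ ≤ A * θ ^ (∑ i, ((k : Fin 3 → ℤ) i).natAbs) / (1 + ∑ i, (((k : Fin 3 → ℤ) i).natAbs : ℝ)) ^ 6) →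
        (∀ (g : ↥(freqBall N : Finset (Fin 3 → ℤ)) → EuclideanSpace ℂ (Fin 3)) (k : ↥(freqBall N : Finset (Fin 3 → ℤ))),
            ((m : ℕ) : ℝ) ^ 2 < freqNormSq (k : Fin 3 → ℤ) → g k = 0 →
            ‖x k‖ = A * θ ^ (∑ i, ((k : Fin 3 → ℤ) i).natAbs) / (1 + ∑ i, (((k : Fin 3 → ℤ) i).natAbs : ℝ)) ^ 6 →
            (inner ℂ (x k) (galerkinRHS (freqBall N : Finset (Fin 3 → ℤ)) ν g x k)).re < 0) ∧
        (∀ (f : UnitAddTorus (Fin 3) → EuclideanSpace ℝ (Fin 3)) (k : ↥(freqBall m : Finset (Fin 3 → ℤ))),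
            ‖coeffExt (freqBall N : Finset (Fin 3 → ℤ)) (galerkinRHS (freqBall N : Finset (Fin 3 → ℤ)) ν (fourierRestrict (freqBall N : Finset (Fin 3 → ℤ)) f) x) (k : Fin 3 → ℤ) -
                galerkinRHS (freqBall m : Finset (Fin 3 → ℤ)) ν (fourierRestrict (freqBall m : Finset (Fin 3 → ℤ)) f)
                  (fun l : ↥(freqBall m : Finset (Fin 3 → ℤ)) => coeffExt (freqBall N : Finset (Fin 3 → ℤ)) x (l : Fin 3 → ℤ)) k‖ ≤
              ν * A * θ ^ (max (∑ j, ((k : Fin 3 → ℤ) j).natAbs) m) / (1 + ((max (∑ j, ((k : Fin 3 → ℤ) j).natAbs) m : ℕ) : ℝ)) ^ 4) ∧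
        2⁻¹ * ∑ k : ↥(freqBall N : Finset (Fin 3 → ℤ)), ‖x k‖ ^ 2 ≤
          2⁻¹ * ∑ l : ↥(freqBall m : Finset (Fin 3 → ℤ)), ‖coeffExt (freqBall N : Finset (Fin 3 → ℤ)) x (l : Fin 3 → ℤ)‖ ^ 2 + δ ∧
        4 * Real.pi ^ 2 * ∑ k : ↥(freqBall N : Finset (Fin 3 → ℤ)), freqNormSq (k : Fin 3 → ℤ) * ‖x k‖ ^ 2 ≤
          4 * Real.pi ^ 2 * ∑ l : ↥(freqBall m : Finset (Fin 3 → ℤ)),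
            freqNormSq (l : Fin 3 → ℤ) * ‖coeffExt (freqBall N : Finset (Fin 3 → ℤ)) x (l : Fin 3 → ℤ)‖ ^ 2 + δ := by
  intro ν A θ δ hν hA hθ hθ1 hδ
  obtain ⟨M₀, h₀⟩ := stub_tailEntrance ν A θ hν hA hθ hθ1
  obtain ⟨M₁, h₁⟩ := stub_tailCoupling ν A θ hν hA hθ hθ1
  obtain ⟨M₂, h₂⟩ := stub_tailSums A θ δ hA hθ hθ1 hδ
  refine ⟨max M₀ (max M₁ M₂), fun m N hMm hmN x hx => ⟨?_, ?_, ?_⟩⟩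
  · exact h₀ m N ((le_max_left _ _).trans hMm) hmN x hx
  · exact h₁ m N (((le_max_left _ _).trans (le_max_right _ _)).trans hMm) hmN x hx
  · exact h₂ m N (((le_max_right _ _).trans (le_max_right _ _)).trans hMm) hmN x hx

end Summit.AnomalousDissipation.AnomalousDissipation.Cruxes.UniformGalerkinTrap.UniformTailEstimatesBirth

end
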